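/-!
# MOVED — not a line, not a skeleton

The round-2 ideator-5 scratch for idea `ch0-null-correspondence-support` lives at the crux root:
`Cruxes/MiddleDivisorSupport/IdeatorFiveSketch.lean` (pad `FixedByDivisorSupportedCorrespondence` → `MiddleDivisorSupport`).
This placeholder exists only because the scratch was first written under `Lines/` by mistake; leads must NOT pick it
(no `stub_*`, no `MiddleDivisorSupport_of`; a crux-plan seat builds the skeleton from the idea card).
-/
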